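import Summits.HodgeConjecture.CorCM.IrreducibleOddWeightsCommutantDomination
import Summits.HodgeConjecture.CorCM.IrreducibleOddWeightsCommutantDensityCMFields
import HarnessLib

/-!
# Density over the commutant, X (CM fields): HODGE DOMINATION — `dim MT(A₀ × A₁) = dim MT(A₀)` IFF
# `X^*(MT(A₁)) ⊆ X^*(MT(A₀))` IFF `MC₁ ≤ S(w₀)` on a trace pivot IFF, in an isotypic class, `D⟨b′⟩ ≤ D⟨b⟩`

COR-CM (cell `pub-hodgecm2`, binder seat `b16` gen 73, count-neutral claim THE BICOMMUTANT AND HODGE DOMINATION,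
file K4 — CM fields; theorems only, no definition, no named fact, no `sorry`).  NEW as stated, hence under
`Summits/`.  HONEST FRAMING: file K3's domination criteria read for CM types of CM number fields inside `ℂ`
(`G = Aut(ℂ)`, `E_i = Hom(K_i, ℂ)`), i.e. for the Mumford–Tate groups of products `A₀ × A₁` of abelian varieties
with complex multiplication (`cmFamilyRank Φ − 1 = dim Hg(A₀ × A₁)`, `cmTypeRank Φ_i − 1 = dim Hg(A_i)`, Pohlmann ∕
Deligne): **`cmFamilyRank Φ = cmTypeRank Φ₀`** says `MT(A₀ × A₁) → MT(A₀)` is an ISOGENY — `A₁` is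
HODGE-DOMINATED by `A₀`.  Galois theory of CM fields and finite-dimensional linear algebra; nothing is claimed about
the algebraicity of Hodge classes; `HC_CM` is neither used nor asserted.

* §1 `cmTypeRank_le_cmFamilyRank` (**`dim Hg(A_i) ≤ dim Hg(A₀ × A₁)`**); **`cmFamilyRank Φ = cmTypeRank Φ_{i₀} ⟺
  ∀ i, MC_i ≤ MC_{i₀}`** (`cmFamilyRank_eq_cmTypeRank_iff_forall_span_coeff_le`), pair form, and the EXCESS
  `cmFamilyRank Φ + dim(MC₀ ∩ MC₁) = cmTypeRank Φ₀ + dim MC₁`.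
* §2 TRACE PIVOTS: for a subfield `T₀ ⊆ K_{i₀}` containing the traces (TR), **`cmFamilyRank Φ = cmTypeRank Φ₀ ⟺
  MC₁ ≤ S(w₀)`**, `w₀` the shadow of `Φ₀` on `Hom(T₀, ℂ)`; with trace subfields on both sides,
  `⟺ S(w₁) = MC₁ ∧ S(w₁) ≤ S(w₀)`.
* §3 IN AN ISOTYPIC CLASS (reference `Aut(ℂ)`-stable irreducible `A ≤ ℚ^{Y}` with commutant `𝒟`, ANY; the shadow
  `w₀ = Σ_j ι⁰_j(b_j)` and the type vector `u₁ = Σ_k ι¹_k(b′_k)` assembled by equivariant, jointly independent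
  embeddings): **`cmFamilyRank Φ = cmTypeRank Φ₀ ⟺ D⟨b′⟩ ≤ D⟨b⟩`**
  (`cmFamilyRank_eq_cmTypeRank_iff_iSup_le_of_commutant`), one component per side **`⟺ b′ ∈ D·b`**, and the excess
  count `cmFamilyRank Φ·δ + dim(D⟨b⟩ ∩ D⟨b′⟩)·dim A = cmTypeRank Φ₀·δ + dim D⟨b′⟩·dim A`.

## References

* [Deligne1982HodgeCycles] P. Deligne, *Hodge cycles on abelian varieties*, LNM 900 (1982), I.5 (p. 53), I Ex. 3.7.
* [Gordon1999HodgeAVSurvey] B. B. Gordon, *A survey of the Hodge conjecture for abelian varieties*, §3 Theorem (Imai,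
  Murty) with proof, 7.5–7.7, 9.4.3.
* [Lang2002] S. Lang, *Algebra*, 3rd ed., VI §1 Thm. 1.1 and Cor. 1.6 (restriction of embeddings), XVII §3.
* [Shimura1998] G. Shimura, *Abelian Varieties with Complex Multiplication and Modular Functions*, §8.1, §18.1.
-/

set_option autoImplicit false

noncomputable section

open scoped BigOperators Classical

universe vY

namespace Summit.HodgeConjecture.CorCM

open CategoryTheory CategoryTheory.Limits NumberField Module IntermediateField
open Literature.NumberTheory.ComplexMultiplication
open Literature.AlgebraicGeometry.Motives (AbelianVariety CMType)
open Literature.AlgebraicGeometry.Motives.AbelianVariety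
open Literature.AlgebraicGeometry.HodgeTheory
open Literature.AlgebraicGeometry.ComplexMultiplication (IsCMTypeRealisation)
open Literature.AlgebraicGeometry.Pohlmann1968

variable {I : Type} [Fintype I] {K : I → Type} [∀ i, Field (K i)] [∀ i, NumberField (K i)] [∀ i, IsCMField (K i)]
  {T₀ : Type} [Field T₀] [NumberField T₀] {T₁ : Type} [Field T₁] [NumberField T₁]
  {Y : Type vY} [MulAction (ℂ ≃+* ℂ) Y] [Fintype Y]

/-! ### §1 Matrix-coefficient spaces -/

/-- **MONOTONICITY `cmTypeRank Φ_i ≤ cmFamilyRank Φ`** (`dim Hg(A_i) ≤ dim Hg(∏_j A_j)`).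
[cite: Deligne1982HodgeCycles, I.5 (p. 53)] [cite: Gordon1999HodgeAVSurvey, 7.7] -/
theorem cmTypeRank_le_cmFamilyRank (Φ : ∀ i, CMType (K i)) (i : I) :
    cmTypeRank (Φ i) ≤ CMAlgebra.cmFamilyRank Φ := by
  haveI : ∀ i, Nonempty (K i →+* ℂ) := fun i => inferInstance
  exact IrrOdd.typeRank_le_typeRank_sigmaType (G := ℂ ≃+* ℂ) (E := fun i => K i →+* ℂ)
    (Φ := fun i => (Φ i).1) (fun i => isCMTypeWith_conj (Φ i)) i

/-- **HODGE DOMINATION (CM fields): `cmFamilyRank Φ = cmTypeRank Φ_{i₀} ⟺ MC_i ≤ MC_{i₀}` for every `i`** —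
`MT(∏_i A_i) → MT(A_{i₀})` is an isogeny iff every `X^*(MT(A_i))_ℚ = MC_i = span{g ↦ u_i(g ∘ x)}` lies in
`MC_{i₀}` inside `ℚ^{Aut(ℂ)}`. [cite: Deligne1982HodgeCycles, I.5 (p. 53) and I Ex. 3.7 (c)]
[cite: Gordon1999HodgeAVSurvey, §3 Theorem (proof), 7.7] -/
theorem cmFamilyRank_eq_cmTypeRank_iff_forall_span_coeff_le (Φ : ∀ i, CMType (K i)) (i₀ : I) :
    CMAlgebra.cmFamilyRank Φ = cmTypeRank (Φ i₀) ↔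
      ∀ i, Submodule.span ℚ (Set.range fun x : K i →+* ℂ => fun g : ℂ ≃+* ℂ => antiVec (Φ i).1 g x) ≤
        Submodule.span ℚ (Set.range fun x : K i₀ →+* ℂ => fun g : ℂ ≃+* ℂ => antiVec (Φ i₀).1 g x) := by
  haveI : ∀ i, Nonempty (K i →+* ℂ) := fun i => inferInstance
  exact IrrOdd.typeRank_sigmaType_eq_typeRank_iff_forall_span_coeff_le (G := ℂ ≃+* ℂ) (E := fun i => K i →+* ℂ)
    (Φ := fun i => (Φ i).1) (fun i => isCMTypeWith_conj (Φ i)) i₀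

/-- Pair form: **`cmFamilyRank Φ = cmTypeRank Φ₀ ⟺ MC₁ ≤ MC₀`** — `A₁` is HODGE-DOMINATED by `A₀`
(`MT(A₀ × A₁) → MT(A₀)` an isogeny). [cite: Deligne1982HodgeCycles, I.5 (p. 53)]
[cite: Gordon1999HodgeAVSurvey, §3 Theorem (proof), 7.5–7.7] -/
theorem cmFamilyRank_eq_cmTypeRank_iff_span_coeff_le_of_pair {i₀ i₁ : I} (hI : ∀ l, l = i₀ ∨ l = i₁)
    (Φ : ∀ i, CMType (K i)) :
    CMAlgebra.cmFamilyRank Φ = cmTypeRank (Φ i₀) ↔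
      Submodule.span ℚ (Set.range fun x : K i₁ →+* ℂ => fun g : ℂ ≃+* ℂ => antiVec (Φ i₁).1 g x) ≤
        Submodule.span ℚ (Set.range fun x : K i₀ →+* ℂ => fun g : ℂ ≃+* ℂ => antiVec (Φ i₀).1 g x) := by
  haveI : ∀ i, Nonempty (K i →+* ℂ) := fun i => inferInstance
  exact IrrOdd.typeRank_sigmaType_eq_typeRank_iff_span_coeff_le_of_pair (G := ℂ ≃+* ℂ) (E := fun i => K i →+* ℂ)
    (Φ := fun i => (Φ i).1) (fun i => isCMTypeWith_conj (Φ i)) hI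

/-- **THE EXCESS `dim Hg(A₀ × A₁) − dim Hg(A₀) = dim MC₁ − dim(MC₀ ∩ MC₁)`**:
`cmFamilyRank Φ + dim(MC₀ ∩ MC₁) = cmTypeRank Φ₀ + dim MC₁`. [cite: Deligne1982HodgeCycles, I.5 (p. 53)]
[cite: Gordon1999HodgeAVSurvey, §3 Theorem (proof), 7.5–7.7] -/
theorem cmFamilyRank_add_finrank_inf_eq_of_pair {i₀ i₁ : I} (h01 : i₀ ≠ i₁) (hI : ∀ l, l = i₀ ∨ l = i₁)
    (Φ : ∀ i, CMType (K i)) :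
    CMAlgebra.cmFamilyRank Φ +
        Module.finrank ℚ ↥(Submodule.span ℚ (Set.range fun x : K i₀ →+* ℂ => fun g : ℂ ≃+* ℂ => antiVec (Φ i₀).1 g x) ⊓
          Submodule.span ℚ (Set.range fun x : K i₁ →+* ℂ => fun g : ℂ ≃+* ℂ => antiVec (Φ i₁).1 g x)) =
      cmTypeRank (Φ i₀) +
        Module.finrank ℚ ↥(Submodule.span ℚ (Set.range fun x : K i₁ →+* ℂ => fun g : ℂ ≃+* ℂ =>
          antiVec (Φ i₁).1 g x)) := by
  haveI : ∀ i, Nonempty (K i →+* ℂ) := fun i => inferInstance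
  exact IrrOdd.typeRank_sigmaType_add_finrank_inf_eq_of_pair (G := ℂ ≃+* ℂ) (E := fun i => K i →+* ℂ)
    (Φ := fun i => (Φ i).1) (fun i => isCMTypeWith_conj (Φ i)) hI h01

/-! ### §2 Trace pivots -/

omit [NumberField T₀] in
/-- **DOMINATION ON A TRACE PIVOT**: for a subfield `T₀ ⊆ K_{i₀}` containing the traces (TR),
**`cmFamilyRank Φ = cmTypeRank Φ₀ ⟺ MC₁ ≤ S(w₀)`**, `S(w₀) = span{g ↦ w₀(g ∘ y) : y ∈ Hom(T₀, ℂ)}` the coefficient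
space of the SHADOW `w₀(y) = Σ_{t|_{T₀} = y} u₀(t)` of `Φ₀`. [cite: Gordon1999HodgeAVSurvey, §3 Theorem (proof), 7.5–7.7
and 9.4.3] [cite: Lang2002, VI §1 Thm. 1.1 and Cor. 1.6] -/
theorem cmFamilyRank_eq_cmTypeRank_iff_span_coeff_le_span_shadow {i₀ i₁ : I} (hI : ∀ l, l = i₀ ∨ l = i₁)
    (Φ : ∀ i, CMType (K i)) [Algebra T₀ (K i₀)]
    (htr₀ : ∀ (a : K i₀ →+* ℂ) (k : K i₀), a k ∈ normalClosure ℚ (K i₁) ℂ → k ∈ Set.range (algebraMap T₀ (K i₀))) :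
    CMAlgebra.cmFamilyRank Φ = cmTypeRank (Φ i₀) ↔
      Submodule.span ℚ (Set.range fun x : K i₁ →+* ℂ => fun g : ℂ ≃+* ℂ => antiVec (Φ i₁).1 g x) ≤
        Submodule.span ℚ (Set.range fun y : T₀ →+* ℂ => fun g : ℂ ≃+* ℂ =>
          ∑ t ∈ Finset.univ.filter (fun t : K i₀ →+* ℂ => t.comp (algebraMap T₀ (K i₀)) = g • y),
            antiVec (Φ i₀).1 (1 : ℂ ≃+* ℂ) t) := by
  haveI : ∀ i, Nonempty (K i →+* ℂ) := fun i => inferInstance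
  exact IrrOdd.typeRank_sigmaType_eq_typeRank_iff_span_coeff_le_span_shadowCoeff_of_fine (G := ℂ ≃+* ℂ)
    (E := fun i => K i →+* ℂ) (Φ := fun i => (Φ i).1) (fun i => isCMTypeWith_conj (Φ i)) hI
    (fun t : K i₀ →+* ℂ => t.comp (algebraMap T₀ (K i₀))) (fun _ _ => rfl)
    (exists_stab_smul_eq_of_comp_eq_of_trace_le i₁ htr₀)

omit [NumberField T₀] [NumberField T₁] in
/-- **DOMINATION FORCES A FAITHFUL TRACE PIVOT**: with trace subfields `T₀ ⊆ K_{i₀}`, `T₁ ⊆ K_{i₁}` (TR) on both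
sides, **`cmFamilyRank Φ = cmTypeRank Φ₀ ⟺ S(w₁) = MC₁ ∧ S(w₁) ≤ S(w₀)`** — a dominated `A₁` loses no rank on its
trace pivot (`dim S(w₁) = dim Hg(A₁)`) and its shadow is absorbed by that of `A₀`.
[cite: Gordon1999HodgeAVSurvey, §3 Theorem (proof), 7.5–7.7 and 9.4.3] [cite: Lang2002, VI §1 Thm. 1.1 and Cor. 1.6] -/
theorem cmFamilyRank_eq_cmTypeRank_iff_of_traces {i₀ i₁ : I} (hI : ∀ l, l = i₀ ∨ l = i₁)
    (Φ : ∀ i, CMType (K i)) [Algebra T₀ (K i₀)] [Algebra T₁ (K i₁)]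
    (htr₀ : ∀ (a : K i₀ →+* ℂ) (k : K i₀), a k ∈ normalClosure ℚ (K i₁) ℂ → k ∈ Set.range (algebraMap T₀ (K i₀)))
    (htr₁ : ∀ (b : K i₁ →+* ℂ) (k : K i₁), b k ∈ normalClosure ℚ (K i₀) ℂ → k ∈ Set.range (algebraMap T₁ (K i₁))) :
    CMAlgebra.cmFamilyRank Φ = cmTypeRank (Φ i₀) ↔
      Submodule.span ℚ (Set.range fun y : T₁ →+* ℂ => fun g : ℂ ≃+* ℂ =>
            ∑ t ∈ Finset.univ.filter (fun t : K i₁ →+* ℂ => t.comp (algebraMap T₁ (K i₁)) = g • y),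
              antiVec (Φ i₁).1 (1 : ℂ ≃+* ℂ) t) =
          Submodule.span ℚ (Set.range fun x : K i₁ →+* ℂ => fun g : ℂ ≃+* ℂ => antiVec (Φ i₁).1 g x) ∧
        Submodule.span ℚ (Set.range fun y : T₁ →+* ℂ => fun g : ℂ ≃+* ℂ =>
            ∑ t ∈ Finset.univ.filter (fun t : K i₁ →+* ℂ => t.comp (algebraMap T₁ (K i₁)) = g • y),
              antiVec (Φ i₁).1 (1 : ℂ ≃+* ℂ) t) ≤
          Submodule.span ℚ (Set.range fun y : T₀ →+* ℂ => fun g : ℂ ≃+* ℂ =>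
            ∑ t ∈ Finset.univ.filter (fun t : K i₀ →+* ℂ => t.comp (algebraMap T₀ (K i₀)) = g • y),
              antiVec (Φ i₀).1 (1 : ℂ ≃+* ℂ) t) := by
  haveI : ∀ i, Nonempty (K i →+* ℂ) := fun i => inferInstance
  exact IrrOdd.typeRank_sigmaType_eq_typeRank_iff_of_fine_of_fine (G := ℂ ≃+* ℂ) (E := fun i => K i →+* ℂ)
    (Φ := fun i => (Φ i).1) (fun i => isCMTypeWith_conj (Φ i)) hI
    (fun t : K i₀ →+* ℂ => t.comp (algebraMap T₀ (K i₀))) (fun t : K i₁ →+* ℂ => t.comp (algebraMap T₁ (K i₁)))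
    (fun _ _ => rfl) (fun _ _ => rfl) (exists_stab_smul_eq_of_comp_eq_of_trace_le i₁ htr₀)
    (exists_stab_smul_eq_of_comp_eq_of_trace_le i₀ htr₁)

/-! ### §3 In an isotypic class: domination over the commutant -/

/-- **HODGE DOMINATION OVER THE COMMUTANT (CM fields).**  `T₀ ⊆ K_{i₀}` a subfield containing the traces (TR);
a reference `Aut(ℂ)`-stable irreducible `A ≤ ℚ^{Y}`, `A ≠ 0`, with commutant `𝒟` (ANY), and equivariant
embeddings `ι⁰_j : ℚ^Y → ℚ^{Hom(T₀,ℂ)}`, `ι¹_k : ℚ^Y → ℚ^{Hom(K_{i₁},ℂ)}`, each family jointly independent on `A`,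
assembling the shadow `w₀ = Σ_j ι⁰_j(b_j)` of `Φ₀` on `Hom(T₀, ℂ)` and the type vector `u₁ = Σ_k ι¹_k(b′_k)` of `Φ₁`.
Then **`cmFamilyRank Φ = cmTypeRank Φ₀ ⟺ D⟨b′⟩ ≤ D⟨b⟩`** — `A₁` is Hodge-dominated by `A₀` iff every component of
its type vector is a `D`-combination of the components of the shadow of `Φ₀`.
[cite: Gordon1999HodgeAVSurvey, §3 Theorem (proof), 7.5–7.7 and 9.4.3] [cite: Lang2002, XVII §3]
[cite: Deligne1982HodgeCycles, I.5 (p. 53)] -/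
theorem cmFamilyRank_eq_cmTypeRank_iff_iSup_le_of_commutant {i₀ i₁ : I} (hI : ∀ l, l = i₀ ∨ l = i₁)
    (Φ : ∀ i, CMType (K i)) [Algebra T₀ (K i₀)]
    (htr₀ : ∀ (a : K i₀ →+* ℂ) (k : K i₀), a k ∈ normalClosure ℚ (K i₁) ℂ → k ∈ Set.range (algebraMap T₀ (K i₀)))
    {A : Submodule ℚ (Y → ℚ)} {𝒟 : Submodule ℚ ((Y → ℚ) →ₗ[ℚ] (Y → ℚ))}
    (h𝒟 : ∀ L : (Y → ℚ) →ₗ[ℚ] (Y → ℚ), L ∈ 𝒟 ↔ (∀ a ∈ A, L a ∈ A) ∧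
      ∀ (k : ℂ ≃+* ℂ) (a : Y → ℚ), a ∈ A → L (fun y => a (k • y)) = fun y => L a (k • y))
    (hAst : ∀ (k : ℂ ≃+* ℂ) (a : Y → ℚ), a ∈ A → (fun y => a (k • y)) ∈ A)
    (hAirr : ∀ W : Submodule ℚ (Y → ℚ), W ≤ A → W ≠ ⊥ →
      (∀ (k : ℂ ≃+* ℂ) (f : Y → ℚ), f ∈ W → (fun y => f (k • y)) ∈ W) → W = A)
    (hA0 : A ≠ ⊥) {J₀ J₁ : Type} [Fintype J₀] [Fintype J₁]
    (ι₀ : J₀ → ((Y → ℚ) →ₗ[ℚ] ((T₀ →+* ℂ) → ℚ))) (ι₁ : J₁ → ((Y → ℚ) →ₗ[ℚ] ((K i₁ →+* ℂ) → ℚ)))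
    (hι₀eq : ∀ (j : J₀) (k : ℂ ≃+* ℂ) (a : Y → ℚ), a ∈ A → ι₀ j (fun y => a (k • y)) = fun y => ι₀ j a (k • y))
    (hι₁eq : ∀ (j : J₁) (k : ℂ ≃+* ℂ) (a : Y → ℚ), a ∈ A → ι₁ j (fun y => a (k • y)) = fun y => ι₁ j a (k • y))
    (hind₀ : ∀ f : J₀ → (Y → ℚ), (∀ j, f j ∈ A) → ∑ j, ι₀ j (f j) = 0 → ∀ j, f j = 0)
    (hind₁ : ∀ f : J₁ → (Y → ℚ), (∀ j, f j ∈ A) → ∑ j, ι₁ j (f j) = 0 → ∀ j, f j = 0)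
    {b₀ : J₀ → (Y → ℚ)} {b₁ : J₁ → (Y → ℚ)} (hb₀ : ∀ j, b₀ j ∈ A) (hb₁ : ∀ j, b₁ j ∈ A)
    (hw₀ : (fun y : T₀ →+* ℂ => ∑ t ∈ Finset.univ.filter (fun t : K i₀ →+* ℂ => t.comp (algebraMap T₀ (K i₀)) = y),
        antiVec (Φ i₀).1 (1 : ℂ ≃+* ℂ) t) = ∑ j, ι₀ j (b₀ j))
    (hu₁ : antiVec (Φ i₁).1 (1 : ℂ ≃+* ℂ) = ∑ j, ι₁ j (b₁ j)) :
    CMAlgebra.cmFamilyRank Φ = cmTypeRank (Φ i₀) ↔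
      (⨆ j, 𝒟.map (LinearMap.applyₗ (b₁ j))) ≤ ⨆ j, 𝒟.map (LinearMap.applyₗ (b₀ j)) := by
  haveI : ∀ i, Nonempty (K i →+* ℂ) := fun i => inferInstance
  exact IrrOdd.typeRank_sigmaType_eq_typeRank_iff_iSup_le_of_class (G := ℂ ≃+* ℂ) (E := fun i => K i →+* ℂ)
    (Φ := fun i => (Φ i).1) (fun i => isCMTypeWith_conj (Φ i)) hI
    (fun t : K i₀ →+* ℂ => t.comp (algebraMap T₀ (K i₀))) (fun _ _ => rfl)
    (exists_stab_smul_eq_of_comp_eq_of_trace_le i₁ htr₀) h𝒟 hAst hAirr hA0 ι₀ ι₁ hι₀eq hι₁eq hind₀ hind₁ hb₀ hb₁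
    hw₀ hu₁

/-- **ONE COMPONENT PER SIDE (CM fields): `cmFamilyRank Φ = cmTypeRank Φ₀ ⟺ b′ ∈ D·b`** (`w₀ = ι⁰(b)`,
`u₁ = ι¹(b′)` for single equivariant embeddings injective on `A`; `A ≠ 0`).
[cite: Gordon1999HodgeAVSurvey, §3 Theorem (proof), 7.5–7.7] [cite: Lang2002, XVII §1 Prop. 1.1 and §3] -/
theorem cmFamilyRank_eq_cmTypeRank_iff_mem_map_applyₗ_of_commutant {i₀ i₁ : I} (hI : ∀ l, l = i₀ ∨ l = i₁)
    (Φ : ∀ i, CMType (K i)) [Algebra T₀ (K i₀)]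
    (htr₀ : ∀ (a : K i₀ →+* ℂ) (k : K i₀), a k ∈ normalClosure ℚ (K i₁) ℂ → k ∈ Set.range (algebraMap T₀ (K i₀)))
    {A : Submodule ℚ (Y → ℚ)} {𝒟 : Submodule ℚ ((Y → ℚ) →ₗ[ℚ] (Y → ℚ))}
    (h𝒟 : ∀ L : (Y → ℚ) →ₗ[ℚ] (Y → ℚ), L ∈ 𝒟 ↔ (∀ a ∈ A, L a ∈ A) ∧
      ∀ (k : ℂ ≃+* ℂ) (a : Y → ℚ), a ∈ A → L (fun y => a (k • y)) = fun y => L a (k • y))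
    (hAst : ∀ (k : ℂ ≃+* ℂ) (a : Y → ℚ), a ∈ A → (fun y => a (k • y)) ∈ A)
    (hAirr : ∀ W : Submodule ℚ (Y → ℚ), W ≤ A → W ≠ ⊥ →
      (∀ (k : ℂ ≃+* ℂ) (f : Y → ℚ), f ∈ W → (fun y => f (k • y)) ∈ W) → W = A)
    (hA0 : A ≠ ⊥) (ι₀ : (Y → ℚ) →ₗ[ℚ] ((T₀ →+* ℂ) → ℚ)) (ι₁ : (Y → ℚ) →ₗ[ℚ] ((K i₁ →+* ℂ) → ℚ))
    (hι₀eq : ∀ (k : ℂ ≃+* ℂ) (a : Y → ℚ), a ∈ A → ι₀ (fun y => a (k • y)) = fun y => ι₀ a (k • y))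
    (hι₁eq : ∀ (k : ℂ ≃+* ℂ) (a : Y → ℚ), a ∈ A → ι₁ (fun y => a (k • y)) = fun y => ι₁ a (k • y))
    (hinj₀ : ∀ f ∈ A, ι₀ f = 0 → f = 0) (hinj₁ : ∀ f ∈ A, ι₁ f = 0 → f = 0)
    {b₀ b₁ : Y → ℚ} (hb₀ : b₀ ∈ A) (hb₁ : b₁ ∈ A)
    (hw₀ : (fun y : T₀ →+* ℂ => ∑ t ∈ Finset.univ.filter (fun t : K i₀ →+* ℂ => t.comp (algebraMap T₀ (K i₀)) = y),
        antiVec (Φ i₀).1 (1 : ℂ ≃+* ℂ) t) = ι₀ b₀)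
    (hu₁ : antiVec (Φ i₁).1 (1 : ℂ ≃+* ℂ) = ι₁ b₁) :
    CMAlgebra.cmFamilyRank Φ = cmTypeRank (Φ i₀) ↔ b₁ ∈ 𝒟.map (LinearMap.applyₗ b₀) := by
  haveI : ∀ i, Nonempty (K i →+* ℂ) := fun i => inferInstance
  exact IrrOdd.typeRank_sigmaType_eq_typeRank_iff_mem_map_applyₗ_of_class (G := ℂ ≃+* ℂ) (E := fun i => K i →+* ℂ)
    (Φ := fun i => (Φ i).1) (fun i => isCMTypeWith_conj (Φ i)) hI
    (fun t : K i₀ →+* ℂ => t.comp (algebraMap T₀ (K i₀))) (fun _ _ => rfl)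
    (exists_stab_smul_eq_of_comp_eq_of_trace_le i₁ htr₀) h𝒟 hAst hAirr hA0 ι₀ ι₁ hι₀eq hι₁eq hinj₀ hinj₁ hb₀ hb₁
    hw₀ hu₁

/-- **THE EXCESS COUNT IN A CLASS (CM fields)**: in the setting of
`cmFamilyRank_eq_cmTypeRank_iff_iSup_le_of_commutant` (`0 ≠ a₀ ∈ A` names `δ`),
**`cmFamilyRank Φ·δ + dim(D⟨b⟩ ∩ D⟨b′⟩)·dim A = cmTypeRank Φ₀·δ + dim D⟨b′⟩·dim A`** —
`(dim Hg(A₀ × A₁) − dim Hg(A₀))·δ = (dim D⟨b′⟩ − dim(D⟨b⟩ ∩ D⟨b′⟩))·dim A`.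
[cite: Gordon1999HodgeAVSurvey, §3 Theorem (proof), 7.5–7.7 and 9.4.3] [cite: Lang2002, XVII §3] -/
theorem cmFamilyRank_mul_add_eq_of_commutant {i₀ i₁ : I} (h01 : i₀ ≠ i₁) (hI : ∀ l, l = i₀ ∨ l = i₁)
    (Φ : ∀ i, CMType (K i)) [Algebra T₀ (K i₀)]
    (htr₀ : ∀ (a : K i₀ →+* ℂ) (k : K i₀), a k ∈ normalClosure ℚ (K i₁) ℂ → k ∈ Set.range (algebraMap T₀ (K i₀)))
    {A : Submodule ℚ (Y → ℚ)} {𝒟 : Submodule ℚ ((Y → ℚ) →ₗ[ℚ] (Y → ℚ))}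
    (h𝒟 : ∀ L : (Y → ℚ) →ₗ[ℚ] (Y → ℚ), L ∈ 𝒟 ↔ (∀ a ∈ A, L a ∈ A) ∧
      ∀ (k : ℂ ≃+* ℂ) (a : Y → ℚ), a ∈ A → L (fun y => a (k • y)) = fun y => L a (k • y))
    (hAst : ∀ (k : ℂ ≃+* ℂ) (a : Y → ℚ), a ∈ A → (fun y => a (k • y)) ∈ A)
    (hAirr : ∀ W : Submodule ℚ (Y → ℚ), W ≤ A → W ≠ ⊥ →
      (∀ (k : ℂ ≃+* ℂ) (f : Y → ℚ), f ∈ W → (fun y => f (k • y)) ∈ W) → W = A)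
    {J₀ J₁ : Type} [Fintype J₀] [Fintype J₁]
    (ι₀ : J₀ → ((Y → ℚ) →ₗ[ℚ] ((T₀ →+* ℂ) → ℚ))) (ι₁ : J₁ → ((Y → ℚ) →ₗ[ℚ] ((K i₁ →+* ℂ) → ℚ)))
    (hι₀eq : ∀ (j : J₀) (k : ℂ ≃+* ℂ) (a : Y → ℚ), a ∈ A → ι₀ j (fun y => a (k • y)) = fun y => ι₀ j a (k • y))
    (hι₁eq : ∀ (j : J₁) (k : ℂ ≃+* ℂ) (a : Y → ℚ), a ∈ A → ι₁ j (fun y => a (k • y)) = fun y => ι₁ j a (k • y))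
    (hind₀ : ∀ f : J₀ → (Y → ℚ), (∀ j, f j ∈ A) → ∑ j, ι₀ j (f j) = 0 → ∀ j, f j = 0)
    (hind₁ : ∀ f : J₁ → (Y → ℚ), (∀ j, f j ∈ A) → ∑ j, ι₁ j (f j) = 0 → ∀ j, f j = 0)
    {b₀ : J₀ → (Y → ℚ)} {b₁ : J₁ → (Y → ℚ)} (hb₀ : ∀ j, b₀ j ∈ A) (hb₁ : ∀ j, b₁ j ∈ A)
    (hw₀ : (fun y : T₀ →+* ℂ => ∑ t ∈ Finset.univ.filter (fun t : K i₀ →+* ℂ => t.comp (algebraMap T₀ (K i₀)) = y),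
        antiVec (Φ i₀).1 (1 : ℂ ≃+* ℂ) t) = ∑ j, ι₀ j (b₀ j))
    (hu₁ : antiVec (Φ i₁).1 (1 : ℂ ≃+* ℂ) = ∑ j, ι₁ j (b₁ j)) {a₀ : Y → ℚ} (ha₀ : a₀ ∈ A) (h0 : a₀ ≠ 0) :
    CMAlgebra.cmFamilyRank Φ * Module.finrank ℚ ↥(𝒟.map (LinearMap.applyₗ a₀)) +
        Module.finrank ℚ ↥((⨆ j, 𝒟.map (LinearMap.applyₗ (b₀ j))) ⊓ ⨆ j, 𝒟.map (LinearMap.applyₗ (b₁ j))) *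
          Module.finrank ℚ A =
      cmTypeRank (Φ i₀) * Module.finrank ℚ ↥(𝒟.map (LinearMap.applyₗ a₀)) +
        Module.finrank ℚ ↥(⨆ j, 𝒟.map (LinearMap.applyₗ (b₁ j))) * Module.finrank ℚ A := by
  haveI : ∀ i, Nonempty (K i →+* ℂ) := fun i => inferInstance
  exact IrrOdd.typeRank_sigmaType_mul_add_eq_of_class (G := ℂ ≃+* ℂ) (E := fun i => K i →+* ℂ)
    (Φ := fun i => (Φ i).1) (fun i => isCMTypeWith_conj (Φ i)) hI h01
    (fun t : K i₀ →+* ℂ => t.comp (algebraMap T₀ (K i₀))) (fun _ _ => rfl)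
    (exists_stab_smul_eq_of_comp_eq_of_trace_le i₁ htr₀) h𝒟 hAst hAirr ι₀ ι₁ hι₀eq hι₁eq hind₀ hind₁ hb₀ hb₁
    hw₀ hu₁ ha₀ h0

end Summit.HodgeConjecture.CorCM

end
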